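import Summits.CriticalPhenomena.PercolationContinuityZ3.Theorems.Transplant.KNLevelsTargetLemma
import Summits.CriticalPhenomena.PercolationContinuityZ3.Theorems.PercNearOneGluingNoHeavyLowerTailCSHTheoremOne
import HarnessLib

/-!
# F6 (generic), part 5 — Kozma–Nitzan Lemma 10 over the levels of any countable locally finite graph, with the gluing hypothesis
# DISCHARGED by the tree's Conjecture 3 (`CSH.kozmaNitzan_conjecture3_holds`, p205010)

builds on p205010 (kernel theorem, internal audit signed; external expert review pending): this file applies the tree theorem
`CSH.kozmaNitzan_conjecture3_holds : KozmaNitzan2024_conjecture3` (`PercNearOneGluingNoHeavyLowerTailCSHTheoremOne.lean`, the closing file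
of stmt-CriticalPhenomena-4575) to remove the gluing hypothesis `hC` of `KNLevels.targetLemma_of_kits`.  Lane `prim-bschramm`, seat
`prim-bschramm-p2` (task F6); helper file (`--supports stmt-CriticalPhenomena-4575`).  Kept separate from `KNLevelsTargetLemma` so that the
generic levels files do not import the p205010 cone.

* `gluing_of_conjecture3` — Conjecture 3 (`KozmaNitzan2024_conjecture3`, all countable vertex TYPES in `Type`) gives the plain gluing
  hypothesis on a fixed countable `V : Type`, hence (`avoidingGluing_of_gluing`) the avoiding form;
* **`targetLemma_of_kits_KN`** — `targetLemma_of_kits` with `hC` discharged: for `V : Type` countable, `G` locally finite of degree `≤ Δ`,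
  `p < 1`: `∀ ε > 0, ∃ δ ∈ (0,1], kits at every level of a long enough level range ⟹ (P(o ↔ B) > 1 - δ ⟹ P(o ↔ T) > 1 - ε)`.
(Universe note: Conjecture 3 is stated over `V : Type`, so this corollary is too; the hypothesis-carrying `targetLemma_of_kits` stays
universe-polymorphic.)

[cite: KozmaNitzan2024, §4 Lemma 10 (pp. 17–22), Conjecture 3 (p. 15)]
-/

noncomputable section

open MeasureTheory ProbabilityTheory
open scoped ENNReal

namespace Summit.CriticalPhenomena.PercolationContinuityZ3.Theorems

namespace Transplant

namespace KNLevels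

open Literature.Probability.Percolation Literature.Probability.LatticeModels SimpleGraph

variable {V : Type} [DecidableEq V] [Countable V] {G : SimpleGraph V} [G.LocallyFinite]

omit [DecidableEq V] [G.LocallyFinite] in
/-- **The gluing hypothesis on a countable vertex type, from Conjecture 3** (the tree theorem `CSH.kozmaNitzan_conjecture3_holds`, in its
finitely-supported target-set form `KozmaNitzan2024_conjecture3.openConn_set`).  builds on p205010 (kernel theorem, internal audit signed;
external expert review pending). [cite: KozmaNitzan2024, Conjecture 3 (p. 15)] -/
theorem gluing_of_conjecture3 (ε : ℝ) (hε : 0 < ε) :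
    ∃ δ : ℝ, 0 < δ ∧ ∀ (w : Sym2 V → unitInterval) (Sf : Finset V),
      (∀ e : Sym2 V, (∃ x ∈ e, x ∉ Sf) → w e = 0) →
      ∀ (A T : Finset V) (o : V), A ⊆ Sf → T ⊆ Sf → o ∈ Sf → T.Nonempty →
        1 - δ < (prodBernoulli w).real (⋃ a ∈ A, openConn o a) →
          (∀ a ∈ A, 1 - δ < (prodBernoulli w).real (⋃ t ∈ T, openConn a t)) →
            1 - ε < (prodBernoulli w).real (⋃ t ∈ T, openConn o t) := by
  obtain ⟨δ, hδ, h⟩ := CSH.kozmaNitzan_conjecture3_holds.openConn_set hε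
  exact ⟨δ, hδ, fun w Sf hw A T o => h V w Sf hw A T o⟩

/-- **Kozma–Nitzan's Lemma 10 over the levels of a countable locally finite graph, unconditionally in the gluing input** (=
`targetLemma_of_kits` with `hC` discharged by Conjecture 3 = `CSH.kozmaNitzan_conjecture3_holds`; the per-level seed/cube KITS remain the
instance's obligation).  For `G` of degree `≤ Δ` and `p < 1`: for every `ε > 0` there is `δ ∈ (0, 1]` such that for every level data with
`LHyp L W p D R`, target `∅ ≠ T ⊆ D`, `N`, level range `[j₀, j₁]`, `j₁ ≤ R`, with `(1-p)^{-ΔN} ≤ δ · #[j₀, j₁]` and a kit at every level,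
`P_W(o ↔ B) > 1 - δ ⟹ P_W(o ↔ T) > 1 - ε`.  builds on p205010 (kernel theorem, internal audit signed; external expert review pending).
[cite: KozmaNitzan2024, §4 Lemma 10 (pp. 17–22) with Conjecture 3 (p. 15)] -/
theorem targetLemma_of_kits_KN {Δ : ℕ} (hΔ : ∀ x, G.degree x ≤ Δ) (p : unitInterval) (hp1 : (p : ℝ) < 1) {ε : ℝ} (hε : 0 < ε) :
    ∃ δ : ℝ, 0 < δ ∧ δ ≤ 1 ∧ ∀ (L : LData G) (W : Sym2 V → unitInterval) (D T : Finset V) (R N j₀ j₁ : ℕ),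
      LHyp L W p D R → j₁ ≤ R → T ⊆ D → T.Nonempty →
      1 / (1 - (p : ℝ)) ^ (Δ * N) ≤ δ * ((Finset.Icc j₀ j₁).card : ℝ) →
      (∀ j ∈ Finset.Icc j₀ j₁, ∃ (σ : SData V) (S : Finset V), SHyp L j σ ∧ σ.N ≤ N ∧
        (1 - (p : ℝ) ^ σ.sB) ^ σ.k ≤ δ ∧ S ⊆ L.X j ∧ S ⊆ D ∧
        (∀ x ∈ σ.K, ∀ e ∈ σ.seed x, e ∉ wireSet (↑S : Set V)) ∧ (∀ x ∈ σ.K, σ.face x ⊆ S) ∧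
        (∀ x ∈ σ.K, 1 - 3 * δ ≤ (prodBernoulli W).real {ω | ∃ u ∈ σ.face x,
          1 - δ < (prodBernoulli (pinW W (wireSet (↑S : Set V)) ω)).real (⋃ t ∈ T, openConnIn (↑D : Set V) u t)})) →
      1 - δ < (prodBernoulli W).real L.reachB →
        1 - ε < (prodBernoulli W).real (⋃ t ∈ T, openConn L.o t) :=
  targetLemma_of_kits hΔ (fun ε' hε' => avoidingGluing_of_gluing (V := V) gluing_of_conjecture3 ε' hε') p hp1 hε

end KNLevels

end Transplant

end Summit.CriticalPhenomena.PercolationContinuityZ3.Theorems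

end
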